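import Summits.ABC.ABC.Theses.IsogenyGlueCongruence
import Summits.ABC.ABC.Theorems.IsogenyGlueCongruenceDegreePrimeCongruenceOfFacts
import Summits.ABC.ABC.Theorems.IsogenyGlueCongruenceDegreePrimesOfCongruenceBound
import HarnessLib

/-!
# Route IsogenyGlueCongruence, item `DegreePrimeCongruenceOfMazurKenku` (stmt-ABC-15127)

The modular input `DegreePrimeCongruence` (stmt-ABC-14828) of the route's `K`-line, derived from the
two rank-9 formal-debt items `MazurKenkuBound` (stmt-ABC-15125, verbatim the Mazur–Kenku comparison
`PastenShimura2024_minimalDegree_le_163_mul`) and `ModularDatumExists` (stmt-ABC-15126, verbatim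
`nonempty_modularParametrizationData`, modularity with an integral Manin constant in datum form):
given a semistable globally minimal `W`, take a datum `D` of `W` at level `N_W` from
`ModularDatumExists` and apply the per-curve theorem
`Summit.ABC.ABC.Theorems.degreePrimeCongruence_of_datum`
(`IsogenyGlueCongruenceDegreePrimeCongruenceOfFacts.lean`: datum branch via Mazur–Kenku, congruence
branch via the tree THEOREM `PastenShimura2024_thm_5_5_holds`).

With the proved glue `DegreePrimesOfCongruenceBound` (stmt-ABC-14897,
`degreePrimesOfCongruenceBound_proof`) the `K`-line of the route then reads over route items only:
`TorsionSharingPrimeBound ∧ MazurKenkuBound ∧ ModularDatumExists ⟹ DegreePrimesPolyBounded`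
(`degreePrimesPolyBounded_of_K_of_mazurKenku` below), superseding
`degreePrimesPolyBounded_of_torsionSharingPrimeBound_of_facts`
(`IsogenyGlueCongruenceDegreePrimesPolyBoundedOfTorsionSharing.lean`), whose Literature-fact
hypotheses are now route items.

Maintenance record (full-build repair, 2026-08-16/17). Route rev 18 (2026-08-16T14:44:06Z,
right-size to the D-0019 caps) dropped the Theses decl `DegreePrimeCongruenceOfMazurKenku`
(stmt-ABC-15127, closed `proved` by `degreePrimeCongruenceOfMazurKenku_proof` below) together with
`DegreePrimeCongruence` (stmt-ABC-14828) and `DegreePrimesOfCongruenceBound` (stmt-ABC-14897). The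
latter two were re-declared by the sibling repairs (`…DegreePrimeCongruenceOfFacts.lean`, p132059;
`…DegreePrimesOfCongruenceBound.lean`), both imported here; the former is named by this file only,
so it is re-created PRIVATELY below with the item's ledger signature verbatim. The theorems of this
file, their names, statement texts and proof scripts are unchanged.

## References

* H. Pasten, *Shimura curves and the abc conjecture*, J. Number Theory 254 (2024), 214–335:
  §3 p. 13, Thm. 5.5 p. 18. [PastenShimura2024]
-/

-- `Summit.ABC.ABC` is the mandated summit-side namespace (CONVENTIONS §2); the duplicate is
-- deliberate.
set_option linter.dupNamespace false

noncomputable section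

/-- PRIVATE re-creation (route namespace stays free; a PROVED, now dropped route statement, NOT a
cited fact and NOT a route item) of the route decl
`…Theses.IsogenyGlueCongruence.DegreePrimeCongruenceOfMazurKenku` = item stmt-ABC-15127, dropped
from `Theses/IsogenyGlueCongruence.lean` at rev 18 (2026-08-16T14:44:06Z): the item's recorded
signature `MazurKenkuBound → ModularDatumExists → DegreePrimeCongruence` verbatim (the third name is
the sibling file's record of stmt-ABC-14828), so that the append-only theorem
`degreePrimeCongruenceOfMazurKenku_proof` keeps elaborating. -/
private def Summit.ABC.ABC.Theses.IsogenyGlueCongruence.DegreePrimeCongruenceOfMazurKenku :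
    Prop :=
  Summit.ABC.ABC.Theses.IsogenyGlueCongruence.MazurKenkuBound →
    Summit.ABC.ABC.Theses.IsogenyGlueCongruence.ModularDatumExists →
      Summit.ABC.ABC.Theses.IsogenyGlueCongruence.DegreePrimeCongruence

namespace Summit.ABC.ABC.Theorems

open Summit.ABC.ABC.Theses.IsogenyGlueCongruence

/-- **`DegreePrimeCongruenceOfMazurKenku` holds** (route `IsogenyGlueCongruence`, item
stmt-ABC-15127): the Mazur–Kenku comparison `MazurKenkuBound` (a minimal-degree datum of a globally
minimal curve has degree `≤ 163 · δ_{1,N}`) and modularity in datum form `ModularDatumExists` give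
`DegreePrimeCongruence` — every prime `ℓ` dividing the degree of a suitable parametrisation of a
semistable globally minimal `W` is `≤ 163` or a congruence prime of `f_W` with another newform of
level `M ∣ N_W`. Proof: take the datum `D` of `W` at level `N_W` from `ModularDatumExists` and apply
`degreePrimeCongruence_of_datum` (datum branch via Mazur–Kenku, congruence branch via Pasten's
Thm. 5.5, a theorem of the tree); `MazurKenkuBound` is the comparison fact verbatim. Semistability
is not used. [cite: PastenShimura2024, §3 p. 13 and Thm. 5.5 p. 18] -/
theorem degreePrimeCongruenceOfMazurKenku_proof :
    Summit.ABC.ABC.Theses.IsogenyGlueCongruence.DegreePrimeCongruenceOfMazurKenku := by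
  unfold Summit.ABC.ABC.Theses.IsogenyGlueCongruence.DegreePrimeCongruenceOfMazurKenku
    Summit.ABC.ABC.Theses.IsogenyGlueCongruence.DegreePrimeCongruence
  intro hMK hmod W _ _ _ _
  obtain ⟨D⟩ := hmod W
  exact degreePrimeCongruence_of_datum hMK D

/-- **The `K`-line of route `IsogenyGlueCongruence` over route items only**: the torsion-sharing
prime bound `TorsionSharingPrimeBound` (crux K), the Mazur–Kenku comparison `MazurKenkuBound` and
modularity in datum form `ModularDatumExists` give crux A, `DegreePrimesPolyBounded` — the proved
glue `degreePrimesOfCongruenceBound_proof` (item `DegreePrimesOfCongruenceBound`, stmt-ABC-14897)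
fed with `degreePrimeCongruenceOfMazurKenku_proof`. Supersedes
`degreePrimesPolyBounded_of_torsionSharingPrimeBound_of_facts`, whose named-fact hypotheses
`exists_isNewformOf`, `PastenShimura2024_thm_5_5` (now a theorem) and
`PastenShimura2024_minimalDegree_le_163_mul` are replaced by the two route items. -/
theorem degreePrimesPolyBounded_of_K_of_mazurKenku (hK : TorsionSharingPrimeBound)
    (hMK : MazurKenkuBound) (hmod : ModularDatumExists) : DegreePrimesPolyBounded :=
  degreePrimesOfCongruenceBound_proof hK (degreePrimeCongruenceOfMazurKenku_proof hMK hmod)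

end Summit.ABC.ABC.Theorems

end
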